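import Mathlib
import HarnessLib
import Summits.Ventures.LatticeQCDFlow.Scaling.SU2IdentityFlowAcceptanceMonotone
import Summits.Ventures.LatticeQCDFlow.Scaling.IdentityFlowAcceptanceCouplingStrict

/-!
# LatticeQCDFlow / Scaling — the untrained factorised SU(2) sampler (class-angle chart): the
# acceptance is STRICTLY decreasing in `β ≥ 0` and strictly increasing in `β ≤ 0`

HONEST FRAMING: exact (Metropolis-corrected) sampling algorithms for lattice gauge theory;
figures of merit are autocorrelation/cost numbers at stated couplings and volumes; no
continuum-physics claim.

Venture `LatticeQCDFlow` (cell pub-lqcd), topic `Scaling`; FANOUT row 3 (`s0-u1-a`, S0-B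
implementation A, GEN-17).  COROLLARY (no new estimate): `Scaling/SU2IdentityFlowAcceptanceMonotone`
(the monotone law, imported) made STRICT by `Scaling/IdentityFlowAcceptanceCouplingStrict` in its
`q ≥ 0` form (imported) — the Haar class density `Q = ∏ (2/π) sin² αᵢ` vanishes at the endpoint
`α = π`, so the level sets are charged where `Q > 0`: the open boxes `(2π/3, 5π/6)^V ⊆ {Σcos < 0, Q > 0}`
and `(π/6, π/3)^V ⊆ {0 < Σcos, Q > 0}` have positive Lebesgue measure.  NO definition is introduced.

* `measure_pi_Ioo_box_pos_su2`, `su2_sum_cos_level`;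
* **`su2IdentityFlow_meanAccept_strictAntiOn`** (STRICTLY decreasing on `[0, ∞)`),
  **`su2IdentityFlow_meanAccept_strictMonoOn`** (strictly increasing on `(−∞, 0]`) — every
  non-empty finite plaquette set; the acceptance of `Scaling/SU2IdentityFlowVolumeLaw` is strictly
  unimodal in `β` with peak `1` at `β = 0`.

Reading (value-free): the zero-training SU(2) row is strictly ordered in the coupling exactly as the
U(1) and product-Haar Wilson rows (`Scaling/IdentityFlowAcceptanceCouplingStrict`).  NOT CLAIMED: the
SU(2) torus; the first-order slope and the holding time in this chart; any value at the cell's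
couplings; nothing re-scored, SEALED.md untouched.
-/

noncomputable section

namespace Summit.Ventures.LatticeQCDFlow.Theory2

open MeasureTheory Real Set Finset
open Summit.Ventures.LatticeQCDFlow.Scoring (onePlaquetteZSU2 onePlaquetteZSU2_pos)

variable {ι : Type*} [Fintype ι] [Nonempty ι]

omit [Nonempty ι] in
/-- A box of positive Lebesgue measure inside `(0, π]^V`. [folklore] -/
theorem measure_pi_Ioo_box_pos_su2 {a b : ℝ} (ha : 0 ≤ a) (hab : a < b) (hb : b ≤ π) :
    0 < (Measure.pi fun _ : ι => volume.restrict (Ioc (0 : ℝ) π)) (Set.pi univ fun _ : ι => Ioo a b) := by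
  rw [Measure.pi_pi]
  refine pos_iff_ne_zero.2 (prod_ne_zero_iff.2 fun i _ => ?_)
  rw [Measure.restrict_apply measurableSet_Ioo,
    inter_eq_left.2 (Ioo_subset_Ioc_self.trans (Ioc_subset_Ioc ha hb)), Real.volume_Ioo]
  exact (ENNReal.ofReal_pos.2 (by linarith)).ne'

/-- **Two-sided level of `T = Σᵢ cos αᵢ` charged where the Haar class density is positive**: the
boxes `(2π/3, 5π/6)^V ⊆ {Σcos < 0, Q > 0}` and `(π/6, π/3)^V ⊆ {0 < Σcos, Q > 0}`
(`Q = ∏ (2/π) sin² > 0` off the endpoints) have positive Lebesgue measure. [ours] -/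
theorem su2_sum_cos_level :
    0 < (Measure.pi fun _ : ι => volume.restrict (Ioc (0 : ℝ) π))
        {x : ι → ℝ | ∑ i, Real.cos (x i) < 0 ∧ 0 < ∏ i, 2 / π * Real.sin (x i) ^ 2} ∧
      0 < (Measure.pi fun _ : ι => volume.restrict (Ioc (0 : ℝ) π))
        {x : ι → ℝ | 0 < ∑ i, Real.cos (x i) ∧ 0 < ∏ i, 2 / π * Real.sin (x i) ^ 2} := by
  have hQ : ∀ x : ι → ℝ, (∀ i, x i ∈ Ioo (0 : ℝ) π) → 0 < ∏ i, 2 / π * Real.sin (x i) ^ 2 :=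
    fun x hx => prod_pos fun i _ => mul_pos (by positivity)
      (pow_pos (Real.sin_pos_of_pos_of_lt_pi (hx i).1 (hx i).2) 2)
  constructor
  · refine lt_of_lt_of_le (measure_pi_Ioo_box_pos_su2 (a := 2 * π / 3) (b := 5 * π / 6)
      (by positivity) (by linarith [Real.pi_pos]) (by linarith [Real.pi_pos]))
      (measure_mono fun x hx => ?_)
    have hx' : ∀ i, x i ∈ Ioo (2 * π / 3) (5 * π / 6) := fun i => (mem_univ_pi.1 hx) i
    refine ⟨sum_neg (fun i _ => ?_) univ_nonempty, hQ x fun i => ⟨by linarith [Real.pi_pos, (hx' i).1],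
      by linarith [Real.pi_pos, (hx' i).2]⟩⟩
    exact Real.cos_neg_of_pi_div_two_lt_of_lt (by linarith [Real.pi_pos, (hx' i).1])
      (by linarith [Real.pi_pos, (hx' i).2])
  · refine lt_of_lt_of_le (measure_pi_Ioo_box_pos_su2 (a := π / 6) (b := π / 3)
      (by positivity) (by linarith [Real.pi_pos]) (by linarith [Real.pi_pos]))
      (measure_mono fun x hx => ?_)
    have hx' : ∀ i, x i ∈ Ioo (π / 6) (π / 3) := fun i => (mem_univ_pi.1 hx) i
    refine ⟨sum_pos (fun i _ => ?_) univ_nonempty, hQ x fun i => ⟨by linarith [Real.pi_pos, (hx' i).1],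
      by linarith [Real.pi_pos, (hx' i).2]⟩⟩
    exact Real.cos_pos_of_mem_Ioo ⟨by linarith [Real.pi_pos, (hx' i).1], by linarith [Real.pi_pos, (hx' i).2]⟩

/-- **THE UNTRAINED FACTORISED SU(2) SAMPLER: `acc_V(β)` IS STRICTLY DECREASING ON `[0, ∞)`** for
every non-empty finite plaquette set — `Scaling/IdentityFlowAcceptanceCouplingStrict` in its
`q ≥ 0` form (the Haar class density vanishes at `α = π`, a null endpoint). [ours] -/
theorem su2IdentityFlow_meanAccept_strictAntiOn :
    StrictAntiOn (fun β : ℝ => ∫ x, ∫ x',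
        min ((∏ i : ι, Real.sin (x i) ^ 2 * Real.exp (β * Real.cos (x i)) / onePlaquetteZSU2 β)
            * ∏ i : ι, (2 / π * Real.sin (x' i) ^ 2))
          ((∏ i : ι, Real.sin (x' i) ^ 2 * Real.exp (β * Real.cos (x' i)) / onePlaquetteZSU2 β)
            * ∏ i : ι, (2 / π * Real.sin (x i) ^ 2))
        ∂(Measure.pi fun _ : ι => volume.restrict (Ioc (0 : ℝ) π))
        ∂(Measure.pi fun _ : ι => volume.restrict (Ioc (0 : ℝ) π))) (Ici 0) := by
  obtain ⟨hq, hqm, hTm, hint, -⟩ := su2IdentityFlow_tilt_facts (ι := ι)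
  obtain ⟨hneg, hpos⟩ := su2_sum_cos_level (ι := ι)
  have hT : ∃ c : ℝ, 0 < (Measure.pi fun _ : ι => volume.restrict (Ioc (0 : ℝ) π))
      {x : ι → ℝ | ∑ i, Real.cos (x i) < c ∧ 0 < ∏ i, 2 / π * Real.sin (x i) ^ 2} ∧
      0 < (Measure.pi fun _ : ι => volume.restrict (Ioc (0 : ℝ) π))
      {x : ι → ℝ | c ≤ ∑ i, Real.cos (x i) ∧ 0 < ∏ i, 2 / π * Real.sin (x i) ^ 2} :=
    ⟨0, hneg, hpos.trans_le (measure_mono fun x hx => ⟨le_of_lt hx.1, hx.2⟩)⟩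
  have h := tiltIMH_meanAccept_strictAntiOn hq hqm hTm (fun γ _ => hint γ) hT
  intro β hβ β' hβ' hββ'
  simp only [su2IdentityFlow_meanAccept_eq_ratio]
  exact h hβ hβ' hββ'

/-- **… AND STRICTLY INCREASING ON `(−∞, 0]`** — strictly unimodal in the coupling, peak `1` at
`β = 0`. [ours] -/
theorem su2IdentityFlow_meanAccept_strictMonoOn :
    StrictMonoOn (fun β : ℝ => ∫ x, ∫ x',
        min ((∏ i : ι, Real.sin (x i) ^ 2 * Real.exp (β * Real.cos (x i)) / onePlaquetteZSU2 β)
            * ∏ i : ι, (2 / π * Real.sin (x' i) ^ 2))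
          ((∏ i : ι, Real.sin (x' i) ^ 2 * Real.exp (β * Real.cos (x' i)) / onePlaquetteZSU2 β)
            * ∏ i : ι, (2 / π * Real.sin (x i) ^ 2))
        ∂(Measure.pi fun _ : ι => volume.restrict (Ioc (0 : ℝ) π))
        ∂(Measure.pi fun _ : ι => volume.restrict (Ioc (0 : ℝ) π))) (Iic 0) := by
  obtain ⟨hq, hqm, hTm, hint, -⟩ := su2IdentityFlow_tilt_facts (ι := ι)
  obtain ⟨hneg, hpos⟩ := su2_sum_cos_level (ι := ι)
  have hT : ∃ c : ℝ, 0 < (Measure.pi fun _ : ι => volume.restrict (Ioc (0 : ℝ) π))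
      {x : ι → ℝ | ∑ i, Real.cos (x i) ≤ c ∧ 0 < ∏ i, 2 / π * Real.sin (x i) ^ 2} ∧
      0 < (Measure.pi fun _ : ι => volume.restrict (Ioc (0 : ℝ) π))
      {x : ι → ℝ | c < ∑ i, Real.cos (x i) ∧ 0 < ∏ i, 2 / π * Real.sin (x i) ^ 2} :=
    ⟨0, hneg.trans_le (measure_mono fun x hx => ⟨le_of_lt hx.1, hx.2⟩), hpos⟩
  have h := tiltIMH_meanAccept_strictMonoOn hq hqm hTm (fun γ _ => hint γ) hT
  intro β hβ β' hβ' hββ'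
  simp only [su2IdentityFlow_meanAccept_eq_ratio]
  exact h hβ hβ' hββ'

end Summit.Ventures.LatticeQCDFlow.Theory2
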